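import Literature.NumberTheory.Automorphic.CuspidalContragredientInfinityType
import HarnessLib

/-!
# The negative of an infinity type: the infinity type of the contragredient

Topic `NumberTheory/Automorphic`. Two small definitions with unfolding API, and the corollary of
`CuspidalContragredientInfinityType` they make statable in one line:

* `ArchWeight.neg p = (-a, -b)` for `p = (a, b)` — the character `z ↦ z^{-a} z̄^{-b}` of `ℂˣ`, the
  inverse (= contragredient) of `z ↦ z^a z̄^b` (Buzzard–Gee 2014, §3.1; `a - b ∈ ℤ` is kept);
* `InfinityType.neg T : σ ↦ {(-a, -b) : (a, b) ∈ T σ}` — the infinity type of the contragredient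
  `π̃` of a representation `π` of infinity type `T` (the Langlands parameter of `(π̃)_v ≅ (π_v)~`
  restricted to `ℂˣ` is the inverse of that of `π_v`; Clozel 1990, §3.3, Borel–Wallach 2000, I §2),
  with `IsWellFormed.neg`, `IsLAlgebraic.neg`, `IsCAlgebraic.neg`, `IsRegular.neg`, `map_a_neg`,
  `neg_neg`;
* `CuspidalAutomorphicRepData.exists_contragredient_satake_hasInfinityType_neg` — for a cuspidal
  datum `π` of `GL_n(𝔸_K)` with infinity type `T` there is a cuspidal datum `π'` (the contragredient
  `(W ∘ τ)/(W' ∘ τ)`) with Satake parameters `α⁻¹` wherever `π` has `α` and with infinity type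
  `T.neg` (`CuspidalAutomorphicRepData.exists_contragredient_satake_archParameter`; Cogdell 2004,
  §2, Thm. 2.1; Knapp 2002, Thm. 5.44).

## References

* K. Buzzard, T. Gee (2014), §3.1. [BuzzardGee2014]
* L. Clozel, *Motifs et formes automorphes* (1990), §3.3. [Clozel1990]
* J. W. Cogdell (2004), §2, Thm. 2.1. [CogdellAnalyticTheory2004]
* A. W. Knapp (2002), Thm. 5.44. [Knapp2002]
-/

noncomputable section

open NumberField IsDedekindDomain

namespace Literature.NumberTheory.Automorphic

namespace ArchWeight

/-- The **negative** `(-a, -b)` of an archimedean weight `(a, b)`: the character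
`z ↦ z^{-a} z̄^{-b}` of `ℂˣ`, inverse of `z ↦ z^a z̄^b` (the side condition `a - b ∈ ℤ` is kept).
Buzzard–Gee 2014, §3.1. [cite: BuzzardGee2014, §3.1] -/
def neg (p : ArchWeight) : ArchWeight where
  a := -p.a
  b := -p.b
  exists_int_sub := by
    obtain ⟨m, hm⟩ := p.exists_int_sub
    exact ⟨-m, by rw [Int.cast_neg, ← hm]; ring⟩

/-- The `a`-exponent of the negative. [cite: BuzzardGee2014, §3.1] -/
@[simp] theorem neg_a (p : ArchWeight) : p.neg.a = -p.a := rfl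

/-- The `b`-exponent of the negative. [cite: BuzzardGee2014, §3.1] -/
@[simp] theorem neg_b (p : ArchWeight) : p.neg.b = -p.b := rfl

/-- `neg` is an involution. [folklore] -/
@[simp] theorem neg_neg (p : ArchWeight) : p.neg.neg = p := by
  ext <;> simp

/-- `neg` commutes with `swap`. [folklore] -/
theorem swap_neg (p : ArchWeight) : p.neg.swap = p.swap.neg := rfl

/-- `neg` and `twist`: `-(p + s) = (-p) + (-s)`. [folklore] -/
theorem neg_twist (p : ArchWeight) (s : ℂ) : (p.twist s).neg = p.neg.twist (-s) := by
  ext <;> simp [add_comm]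

end ArchWeight

namespace InfinityType

variable {K : Type*} [Field K] {n : ℕ}

/-- The **negative** of an infinity type: `T.neg σ = {(-a, -b) : (a, b) ∈ T σ}` — the infinity type
of the contragredient `π̃` of a representation of infinity type `T` (the Langlands parameter of
`(π̃)_v ≅ (π_v)~` on `ℂˣ` is the inverse of that of `π_v`). Clozel 1990, §3.3; Borel–Wallach 2000,
I §2. [cite: Clozel1990, §3.3] -/
def neg (T : InfinityType K n) : InfinityType K n := fun σ => (T σ).map ArchWeight.neg

/-- Unfolding `neg` at an embedding. [cite: Clozel1990, §3.3] -/
@[simp] theorem neg_apply (T : InfinityType K n) (σ : K →+* ℂ) : T.neg σ = (T σ).map ArchWeight.neg :=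
  rfl

/-- The `a`-multisets of `T.neg` are the negated `a`-multisets of `T`. [cite: Clozel1990, §3.3] -/
theorem map_a_neg (T : InfinityType K n) (σ : K →+* ℂ) :
    (T.neg σ).map ArchWeight.a = ((T σ).map ArchWeight.a).map Neg.neg := by
  rw [neg_apply, Multiset.map_map, Multiset.map_map]
  rfl

/-- `neg` is an involution. [folklore] -/
@[simp] theorem neg_neg (T : InfinityType K n) : T.neg.neg = T := by
  funext σ
  simp [Multiset.map_map]

/-- Negation preserves well-formedness (`neg` commutes with `swap`). [cite: BuzzardGee2014, §3.1] -/
theorem IsWellFormed.neg {T : InfinityType K n} (h : T.IsWellFormed) : T.neg.IsWellFormed := by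
  refine ⟨fun σ => by rw [neg_apply, Multiset.card_map, h.1 σ], fun σ => ?_⟩
  rw [neg_apply, neg_apply, h.2 σ, Multiset.map_map, Multiset.map_map]
  rfl

/-- Negation preserves `L`-algebraicity. [cite: BuzzardGee2014, Definition 3.1.1] -/
theorem IsLAlgebraic.neg {T : InfinityType K n} (h : T.IsLAlgebraic) : T.neg.IsLAlgebraic := by
  intro σ p hp
  obtain ⟨p₀, hp₀, rfl⟩ := Multiset.mem_map.1 hp
  obtain ⟨k, l, hk, hl⟩ := h σ p₀ hp₀
  exact ⟨-k, -l, by rw [ArchWeight.neg_a, hk, Int.cast_neg], by rw [ArchWeight.neg_b, hl, Int.cast_neg]⟩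

/-- Negation preserves `C`-algebraicity (`-(k + (n-1)/2) = (-k - (n-1)) + (n-1)/2`).
[cite: BuzzardGee2014, Definition 5.3.3] -/
theorem IsCAlgebraic.neg {T : InfinityType K n} (h : T.IsCAlgebraic) : T.neg.IsCAlgebraic := by
  intro σ p hp
  obtain ⟨p₀, hp₀, rfl⟩ := Multiset.mem_map.1 hp
  obtain ⟨k, l, hk, hl⟩ := h σ p₀ hp₀
  refine ⟨-k - (n - 1 : ℤ), -l - (n - 1 : ℤ), ?_, ?_⟩
  · rw [ArchWeight.neg_a, hk]; push_cast; ring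
  · rw [ArchWeight.neg_b, hl]; push_cast; ring

/-- Negation preserves regularity. [cite: Clozel1990, Définition 3.12] -/
theorem IsRegular.neg {T : InfinityType K n} (h : T.IsRegular) : T.neg.IsRegular := fun σ => by
  rw [map_a_neg]
  exact (h σ).map neg_injective

/-- Negation preserves regular algebraicity. [cite: Clozel1990, Définitions 1.8 and 3.12] -/
theorem IsRegularAlgebraic.neg {T : InfinityType K n} (h : T.IsRegularAlgebraic) :
    T.neg.IsRegularAlgebraic :=
  ⟨h.1.neg, h.2.neg⟩

end InfinityType

/-- **The contragredient of a cuspidal automorphic representation of `GL_n(𝔸_K)` has the negative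
infinity type.**  For a cuspidal datum `π` with infinity type `T` there is a cuspidal datum `π'` —
the contragredient `(W ∘ τ)/(W' ∘ τ)`, `τ(g) = w₀ ᵗg⁻¹ w₀` — with Satake parameter `α⁻¹` wherever `π`
has `α`, and with infinity type `T.neg` (`σ ↦ {(-a, -b)}`). Cogdell 2004, §2, Thm. 2.1 (`π̃` is
cuspidal, realised on `φ(ᵗg⁻¹)`); Getz–Hahn 2024, Prop. 7.6.2 (Satake); Knapp 2002, Thm. 5.44
(infinitesimal character of the contragredient).
[cite: CogdellAnalyticTheory2004, §2 Thm. 2.1 and §1 after Thm. 1.2] [cite: Knapp2002, §V.5 Thm. 5.44] -/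
theorem CuspidalAutomorphicRepData.exists_contragredient_satake_hasInfinityType_neg {n : ℕ} {K : Type}
    [Field K] [NumberField K] (hcpt : isCompact_glFiniteIntegralLevel n K)
    (π : CuspidalAutomorphicRepData n K hcpt) {T : InfinityType K n} (hT : π.1.HasInfinityType T) :
    ∃ π' : CuspidalAutomorphicRepData n K hcpt,
      (∀ (v : HeightOneSpectrum (𝓞 K)) (α : Multiset ℂ),
        π.1.HasSatakeParamAt v α → π'.1.HasSatakeParamAt v (α.map (·⁻¹))) ∧
      π'.1.HasInfinityType T.neg := by
  obtain ⟨π', hsat, -, hinf⟩ := CuspidalAutomorphicRepData.exists_contragredient_satake_archParameter hcpt π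
  exact ⟨π', hsat, hinf T T.neg hT hT.1.neg T.map_a_neg⟩

end Literature.NumberTheory.Automorphic
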